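import Mathlib
import Summits.Ventures.PercRepro2.CoinForestHead
import Summits.Ventures.PercRepro2.CoinPin
import Summits.Ventures.PercRepro2.CoinPreHead
import Summits.Ventures.PercRepro2.CoinLemmaA

/-!
# A null coin can be deleted; the forest theorem with a DIRECT ARM `w → t` for an unentered head
(blind cell PercRepro2, night-2 g6; proofs/NIGHT2-DARC.md §29.8)

`darc_of_null_coin_erase`: pinned closed (`p e = 0`), a coin can be deleted from the arc map
(`Function.update arcs e ∅`) without changing the gate functional — the two systems agree on every
configuration where `e` is closed, and those are the only ones of positive weight.
`darc_of_forestHead_directArm`: the forest theorem's head `w`, when NO coin enters it, may also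
carry a direct arm `e = {w → t}` of any probability: pinned closed the arm is deleted and the forest
theorem applies; pinned open `w ∈ K⁻` is sure, the gate `u → w` is the avoidance event
`R_{T ∪ {u}}` and its functional is Lemma A (`phiC_avoid_insert_nonneg`, from directed BHK and the
monotone shift `shift_avoid_more_C`).  This closes the «direct arm» gap of §27.10 for unentered
heads; the affine lemma `darc_of_pin_of_dependsOn` does the interpolation.
-/

namespace Summit.Ventures.PercRepro2.Coin

open Classical

section NullErase

variable {V : Type*} {E : Type*} [Fintype E] [DecidableEq E] {R : Type*} [CommRing R]

omit [Fintype E] [CommRing R] in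
/-- With `e` closed, reachability does not see whether `e` carries arcs. -/
lemma reach_erase_iff {arcs : E → Finset (V × V)} {e : E} {ω : Config E} (hω : ω e = false)
    (x y : V) : Reach (Function.update arcs e ∅) ω x y ↔ Reach arcs ω x y := by
  constructor
  · intro h
    induction h with
    | refl => exact reach_refl _ _ _
    | tail _ hstep ih =>
      obtain ⟨e', he', hmem⟩ := hstep
      by_cases hee : e' = e
      · subst hee
        simp at hmem
      · rw [Function.update_of_ne hee] at hmem
        exact reach_trans ih (reach_of_openArc ⟨e', he', hmem⟩)
  · intro h
    induction h with
    | refl => exact reach_refl _ _ _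
    | tail _ hstep ih =>
      obtain ⟨e', he', hmem⟩ := hstep
      by_cases hee : e' = e
      · subst hee
        rw [hω] at he'
        exact absurd he' Bool.false_ne_true
      · exact reach_trans ih (reach_of_openArc ⟨e', he', by rw [Function.update_of_ne hee]; exact hmem⟩)

omit [Fintype E] [CommRing R] in
/-- With `e` closed, the gate events of the two arc maps agree. -/
lemma gateEvent_erase_iff {arcs : E → Finset (V × V)} {e : E} {ω : Config E} (hω : ω e = false)
    (s : V) (T : Finset V) (u w : V) :
    ω ∈ gateEvent (Function.update arcs e ∅) s T u w ↔ ω ∈ gateEvent arcs s T u w := by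
  simp only [gateEvent, Set.mem_setOf_eq, reachPlus_iff, reach_erase_iff hω]

omit [Fintype E] [CommRing R] in
/-- With `e` closed, the avoidance events of the two arc maps agree. -/
lemma avoidEvent_erase_iff {arcs : E → Finset (V × V)} {e : E} {ω : Config E} (hω : ω e = false)
    (s : V) (T : Finset V) :
    ω ∈ avoidEvent (Function.update arcs e ∅) s T ↔ ω ∈ avoidEvent arcs s T := by
  simp only [avoidEvent, Set.mem_setOf_eq, reach_erase_iff hω]

omit [Fintype E] in
/-- With `e` closed, the markers of the two arc maps agree. -/
lemma marker_erase_eq {arcs : E → Finset (V × V)} {e : E} {ω : Config E} (hω : ω e = false)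
    (s a : V) : marker (R := R) (Function.update arcs e ∅) s a ω = marker (R := R) arcs s a ω := by
  simp only [marker, reach_erase_iff hω]

/-- Under a null coin the restricted expectations of the two arc maps' markers agree. -/
lemma massE_marker_erase (p : E → R) {e : E} (hp : p e = 0)
    (f g : Config E → R) (hfg : ∀ ω, ω e = false → f ω = g ω) {A B : Set (Config E)}
    (hAB : ∀ ω, ω e = false → (ω ∈ A ↔ ω ∈ B)) : massE p f A = massE p g B := by
  unfold massE expect
  refine Finset.sum_congr rfl fun ω _ => ?_
  by_cases hω : ω e = true
  · rw [weight_eq_zero_of_null hp hω, zero_mul, zero_mul]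
  · simp only [Bool.not_eq_true] at hω
    by_cases hA : ω ∈ A
    · rw [Set.indicator_of_mem hA, Set.indicator_of_mem ((hAB ω hω).mp hA), hfg ω hω]
    · rw [Set.indicator_of_notMem hA, Set.indicator_of_notMem (fun hB => hA ((hAB ω hω).mpr hB))]

/-- **A null coin can be deleted from the arc map**: the gate functionals of `arcs` and of
`arcs` with `e` erased agree when `p e = 0`. -/
theorem phiC_gate_erase (p : E → R) {e : E} (hp : p e = 0) (arcs : E → Finset (V × V)) (s : V)
    (T : Finset V) (a b u w : V) :
    phiC p arcs s T a b (gateEvent arcs s T u w) =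
      phiC p (Function.update arcs e ∅) s T a b (gateEvent (Function.update arcs e ∅) s T u w) := by
  simp only [phiC, prob_eq_massE_one]
  have hR : ∀ ω : Config E, ω e = false →
      (ω ∈ avoidEvent arcs s T ↔ ω ∈ avoidEvent (Function.update arcs e ∅) s T) :=
    fun ω hω => (avoidEvent_erase_iff hω s T (arcs := arcs)).symm
  have hG : ∀ ω : Config E, ω e = false →
      (ω ∈ gateEvent arcs s T u w ↔ ω ∈ gateEvent (Function.update arcs e ∅) s T u w) :=
    fun ω hω => (gateEvent_erase_iff hω s T u w (arcs := arcs)).symm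
  have hX : ∀ ω : Config E, ω e = false →
      marker (R := R) arcs s a ω = marker (R := R) (Function.update arcs e ∅) s a ω :=
    fun ω hω => (marker_erase_eq (R := R) hω s a (arcs := arcs)).symm
  have hY : ∀ ω : Config E, ω e = false →
      marker (R := R) arcs s b ω = marker (R := R) (Function.update arcs e ∅) s b ω :=
    fun ω hω => (marker_erase_eq (R := R) hω s b (arcs := arcs)).symm
  set arcs' := Function.update arcs e ∅ with harcs'
  have h1 : massE p (fun _ : Config E => (1 : R)) (avoidEvent arcs s T) =
      massE p (fun _ : Config E => (1 : R)) (avoidEvent arcs' s T) :=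
    massE_marker_erase p hp _ _ (fun _ _ => rfl) hR
  have h2 : massE p (marker (R := R) arcs s a) (avoidEvent arcs s T) =
      massE p (marker (R := R) arcs' s a) (avoidEvent arcs' s T) :=
    massE_marker_erase p hp _ _ hX hR
  have h3 : massE p (marker (R := R) arcs s b) (avoidEvent arcs s T) =
      massE p (marker (R := R) arcs' s b) (avoidEvent arcs' s T) :=
    massE_marker_erase p hp _ _ hY hR
  have h4 : massE p (fun ω => marker (R := R) arcs s a ω * marker (R := R) arcs s b ω)
        (gateEvent arcs s T u w) =
      massE p (fun ω => marker (R := R) arcs' s a ω * marker (R := R) arcs' s b ω)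
        (gateEvent arcs' s T u w) :=
    massE_marker_erase p hp _ _ (fun ω hω => by simp only [hX ω hω, hY ω hω]) hG
  have h5 : massE p (marker (R := R) arcs s a) (gateEvent arcs s T u w) =
      massE p (marker (R := R) arcs' s a) (gateEvent arcs' s T u w) :=
    massE_marker_erase p hp _ _ hX hG
  have h6 : massE p (marker (R := R) arcs s b) (gateEvent arcs s T u w) =
      massE p (marker (R := R) arcs' s b) (gateEvent arcs' s T u w) :=
    massE_marker_erase p hp _ _ hY hG
  have h7 : massE p (fun _ : Config E => (1 : R)) (gateEvent arcs s T u w) =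
      massE p (fun _ : Config E => (1 : R)) (gateEvent arcs' s T u w) :=
    massE_marker_erase p hp _ _ (fun _ _ => rfl) hG
  rw [h1, h2, h3, h4, h5, h6, h7]

end NullErase

/-! ### The forest theorem with a direct arm `w → t` at an unentered head -/

section DirectArm

variable {V : Type*} {E : Type*} [Fintype V] [DecidableEq V] [Fintype E] [DecidableEq E]
  {R : Type*} [Field R] [LinearOrder R] [IsStrictOrderedRing R]

omit [Fintype V] [Fintype E] [DecidableEq E] [Field R] [LinearOrder R] [IsStrictOrderedRing R] in
/-- With the direct arm `w → t` open (`t ∈ T`), `w ∈ K⁻`, so the gate `u → w` is `R_{T ∪ {u}}`. -/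
lemma gateEvent_iff_of_sureDirect {arcs : E → Finset (V × V)} {e : E} {w t : V}
    (he : arcs e = {(w, t)}) {T : Finset V} (ht : t ∈ T) (s u : V) {ω : Config E}
    (hω : ω e = true) : ω ∈ gateEvent arcs s T u w ↔ ω ∈ avoidEvent arcs s (T ∪ {u}) := by
  rw [gateEvent_eq_union]
  have hwK : ω ∈ bwdEvent arcs w T :=
    ⟨t, ht, reach_of_openArc ⟨e, hω, by rw [he]; exact Finset.mem_singleton_self _⟩⟩
  simp only [Set.mem_inter_iff, Set.mem_union, Set.mem_compl_iff, avoidEvent, fwdEvent,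
    Set.mem_setOf_eq, Finset.mem_union, Finset.mem_singleton]
  constructor
  · rintro ⟨hR, h | h⟩
    · intro t' ht'
      rcases ht' with ht' | rfl
      · exact hR t' ht'
      · exact h
    · exact absurd hwK h
  · intro h
    exact ⟨fun t' ht' => h t' (Or.inl ht'), Or.inl (h u (Or.inr rfl))⟩

omit [Fintype V] [Fintype E] [Field R] [LinearOrder R] [IsStrictOrderedRing R] in
/-- Erasing a coin whose arcs all have tails in `Z` does not change `arcsOff arcs Z`. -/
lemma arcsOff_update_empty {arcs : E → Finset (V × V)} {e : E} {Z : Finset V}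
    (he : ∀ xy ∈ arcs e, xy.1 ∈ Z) : arcsOff (Function.update arcs e ∅) Z = arcsOff arcs Z := by
  funext e'
  by_cases hee : e' = e
  · subst hee
    ext xy
    simp only [arcsOff, Function.update_self, Finset.filter_empty, Finset.notMem_empty,
      Finset.mem_filter, false_iff, not_and, not_not]
    exact fun hxy => he xy hxy
  · simp only [arcsOff, Function.update_of_ne hee]

omit [Fintype V] [DecidableEq V] [Fintype E] [DecidableEq E] [Field R] [LinearOrder R]
  [IsStrictOrderedRing R] in
/-- A coin carrying no arc is never seen by reachability. -/
lemma reach_of_reach_of_empty {arcs : E → Finset (V × V)} {e : E} (he : arcs e = ∅)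
    {ω ω' : Config E} (hωω' : ∀ e' ∈ ({e}ᶜ : Set E), ω e' = ω' e') {x y : V}
    (h : Reach arcs ω x y) : Reach arcs ω' x y := by
  induction h with
  | refl => exact reach_refl _ _ _
  | tail _ hstep ih =>
    obtain ⟨e', he', hmem⟩ := hstep
    by_cases hee : e' = e
    · subst hee
      rw [he] at hmem
      exact absurd hmem (Finset.notMem_empty _)
    · exact reach_trans ih (reach_of_openArc ⟨e', by rw [← hωω' e' (by simpa using hee)]; exact he', hmem⟩)

omit [Fintype V] [DecidableEq V] [Fintype E] [DecidableEq E] [Field R] [LinearOrder R]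
  [IsStrictOrderedRing R] in
/-- An avoidance event of an arc map in which `e` carries no arc does not depend on `e`. -/
lemma dependsOn_avoidEvent_of_empty {arcs : E → Finset (V × V)} {e : E} (he : arcs e = ∅)
    (s : V) (T : Finset V) : DependsOn (· ∈ avoidEvent arcs s T) ({e}ᶜ : Set E) := by
  intro ω ω' hωω'
  simp only [avoidEvent, Set.mem_setOf_eq]
  apply propext
  constructor
  · intro h t ht hr
    exact h t ht (reach_of_reach_of_empty he (fun e' he' => (hωω' e' he').symm) hr)
  · intro h t ht hr
    exact h t ht (reach_of_reach_of_empty he hωω' hr)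

/-- **The forest theorem with a DIRECT ARM `w → t` at an unentered head.**  The head `w` of a
pendant forest (arms `c v = {w → v}` into `A ⊆ Vs`, forest coins `d v = {v → par v}`) also carries
the coin `e = {w → t}` of any probability; no coin enters `w`, `w ≠ s`; apart from `e`, the arm and
forest coins are the only coins leaving `{w} ∪ Vs`.  Then row 2′DARC holds at `u → w`. -/
theorem darc_of_forestHead_directArm (p : E → R) (hp : IsProbVec p) {arcs : E → Finset (V × V)}
    (hS : SameEnds arcs) (s a b u w t : V) (e : E) (he : arcs e = {(w, t)})
    (hin : ∀ e', ∀ xy ∈ arcs e', xy.2 ≠ w) (hs : s ≠ w) (Vs : Finset V) (hwV : w ∉ Vs)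
    (htV : t ∉ Vs) (hwt : w ≠ t) (A : Finset V) (hAV : A ⊆ Vs) {c d : V → E} {par : V → V}
    (hc : ∀ v ∈ A, arcs (c v) = {(w, v)}) (hce : ∀ v ∈ A, c v ≠ e)
    (hd : ∀ v ∈ Vs, arcs (d v) = {(v, par v)}) (hde : ∀ v ∈ Vs, d v ≠ e)
    (hpar : ∀ v ∈ Vs, par v ∈ Vs ∨ par v = t)
    (honly : ∀ e', e' ≠ e → (∃ xy ∈ arcs e', xy.1 = w ∨ xy.1 ∈ Vs) →
      (∃ v ∈ A, e' = c v) ∨ (∃ v ∈ Vs, e' = d v))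
    {rk : V → ℕ} (hrk : ∀ v ∈ Vs, par v ∈ Vs → rk (par v) < rk v)
    (ha : a ∉ insert w Vs ∪ {t}) (hb : b ∉ insert w Vs ∪ {t}) (hu : u ∉ insert w Vs ∪ {t})
    (hP : ∀ Z ∈ (insert w Vs).powerset,
      0 < prob p (avoidEvent (arcsOff arcs (insert w Vs ∪ {t})) s (Z ∪ {t})))
    (hQ : ∀ Z ∈ (insert w Vs).powerset,
      0 < prob p (avoidEvent (arcsOff arcs (insert w Vs ∪ {t})) s (gateTarget u w Z {t}))) :
    DARC p arcs s {t} a b u w := by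
  have he' : ∀ xy ∈ arcs e, xy.1 = w := fun xy hxy => by
    rw [he, Finset.mem_singleton] at hxy
    subst hxy
    rfl
  have hsS : SameEnds (Function.update arcs e ∅) := by
    intro e' xy hxy x'y' hx'y'
    by_cases hee : e' = e
    · subst hee
      simp at hxy
    · rw [Function.update_of_ne hee] at hxy hx'y'
      exact hS e' xy hxy x'y' hx'y'
  refine darc_of_pin_of_dependsOn p arcs s {t} a b u w e (hp.nonneg e) (hp.le_one e)
    (dependsOn_avoidEvent_of_unentered hin he' hs {t})
    (dependsOn_marker_of_unentered hin he' hs a) (dependsOn_marker_of_unentered hin he' hs b)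
    ?_ ?_
  · -- pinned open: `w ∈ K⁻` is sure, the gate is `R_{T ∪ {u}}` and its functional is Lemma A
    unfold DARC
    rw [phiC_congr_of_sure (Function.update p e 1) arcs s {t} a b (e := e) (by simp)
      (fun ω hω => gateEvent_iff_of_sureDirect he (Finset.mem_singleton_self t) s u hω)]
    exact lemmaA_nonneg _ (isProbVec_update_one hp e) hS s {t} {u} a b
  · -- pinned closed: erase the arm and apply the forest theorem
    unfold DARC
    rw [phiC_gate_erase (Function.update p e 0) (e := e) (by simp) arcs s {t} a b u w]
    have hoff : arcsOff (Function.update arcs e ∅) (insert w Vs ∪ {t}) =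
        arcsOff arcs (insert w Vs ∪ {t}) :=
      arcsOff_update_empty fun xy hxy => by
        rw [he' xy hxy]; exact Finset.mem_union_left _ (Finset.mem_insert_self w Vs)
    have hprob : ∀ T' : Finset V, prob (Function.update p e 0)
        (avoidEvent (arcsOff arcs (insert w Vs ∪ {t})) s T') =
        prob p (avoidEvent (arcsOff arcs (insert w Vs ∪ {t})) s T') := by
      intro T'
      simp only [prob_eq_expect_indicator]
      refine expect_update_zero_of_dependsOn p (dependsOn_indicator_mul ?_ dependsOn_one)
      refine dependsOn_avoidEvent_of_empty ?_ s T'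
      ext xy
      simp only [arcsOff, Finset.mem_filter, Finset.notMem_empty, iff_false, not_and, not_not]
      intro hxy
      rw [he' xy hxy]
      exact Finset.mem_union_left _ (Finset.mem_insert_self w Vs)
    refine darc_of_forestHead_mixed (Function.update p e 0) (isProbVec_update_zero hp e) hsS s a b
      u w t Vs hwV htV hwt A hAV (c := c) (d := d) (par := par) ?_ ?_ hpar ?_ (rk := rk) hrk
      ha hb hu ?_ ?_
    · intro v hv
      rw [Function.update_of_ne (hce v hv)]
      exact hc v hv
    · intro v hv
      rw [Function.update_of_ne (hde v hv)]
      exact hd v hv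
    · intro e' hxy
      obtain ⟨xy, hxy, hx⟩ := hxy
      by_cases hee : e' = e
      · subst hee
        simp at hxy
      · rw [Function.update_of_ne hee] at hxy
        exact honly e' hee ⟨xy, hxy, hx⟩
    · intro Z hZ
      rw [hoff, hprob]
      exact hP Z hZ
    · intro Z hZ
      rw [hoff, hprob]
      exact hQ Z hZ

end DirectArm

end Summit.Ventures.PercRepro2.Coin
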